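import Summits.CriticalPhenomena.SAWScalingLimit.Theorems.SAWDevelopingMapInteriorFlatteningSpinDictionary
import Summits.CriticalPhenomena.SAWScalingLimit.Theorems.SAWDevelopingMapInteriorFlatteningOneScaleGlue
import Summits.CriticalPhenomena.SAWScalingLimit.Theorems.SAWDevelopingMapObservableToSLECanonicalTransferLatticePaths

/-!
# Lattice Harnack chains under bulk no-fold (crux `InteriorFlattening`, stmt-CriticalPhenomena-8297)

Line `liouville-local-limits` (lead `prover-line-stmt-CriticalPhenomena-8297-c1-0`), helper for the
stubs `stub_compactnessAtOrigin` (S2) and `stub_uniquenessReduction` (S7), written by the worker of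
the slot `stub_intrusionTail` (S6'). TOOL, not a closure: nothing open is asserted, the bulk no-fold
bound enters only as the HYPOTHESIS `DepthFlat R₀ k` (`k < 1`) of
`…Theorems.SAWDevelopingMapInteriorFlatteningOneMouthDefs` (= `RatioAtDepth R₀ k` of the Liouville
Defs module, bridged in `…LiouvilleHarnack.lean`).

For the Duminil-Copin–Smirnov observable `F = F(a, ·, x_c, 5/8)` of a simply connected domain `Λ`
with boundary root `a`, at a vertex `v ∈ Λ` with frame `(w₀, w₁, w₂)`:

* `modes_bounds` — inverse `ℤ/3`-Fourier transform (pure algebra): if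
  `F₀ + ω²F₁ + ωF₂ = 0` and `‖F₀ + ωF₁ + ω²F₂‖ ≤ k ‖F₀ + F₁ + F₂‖` then
  `(1-k)‖M‖ ≤ 3‖Fᵢ‖ ≤ (1+k)‖M‖` for `i = 0, 1, 2` (`3F₀ = M + B`, `3F₁ = M + ω²B`, `3F₂ = M + ωB`);
* `star_bounds` — at an `R₀`-deep vertex of `Λ` under `DepthFlat R₀ k` the same three two-sided
  bounds hold for the observable: one of the two labellings of the star is counter-clockwise, where
  DCS Lemma 1 kills the `ω`-combination (`OneMouth.bel_eq_zero_of_ccw`, `hexStar_directions`), and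
  the no-fold hypothesis bounds the other one;
* `norm_Fobs_le_of_adj` — hence any two edge moduli at a deep vertex compare with the
  quasiconformal constant `K = (1+k)/(1-k)`, and `mono = 0 ↔` the star vanishes
  (`mono_eq_zero_iff`, `mono_eq_zero_of_Fobs_eq_zero`);
* `chain` — along a lattice walk of length `m` through `R₀`-deep vertices, edge moduli at the two
  ends compare with `K^(m+1)`; with the greedy lattice paths of
  `…ObservableToSLECanonicalTransferLatticePaths` (`exists_walk_dist_le_dist`: a walk from `v` to
  `v₀` inside the disc through `c_v`), every vertex of the walk is `R₀`-deep as soon as `v₀` is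
  `(dist(c_v, c_{v₀}) + max R₀ 0)`-deep (`support_deep`), whence
* `bounds_of_deep`, `Fobs_le_mono_of_deep` (registered sub-goal), `mono_le_Fobs_of_deep` — for
  every edge `z` there are `C, N` (depending on `z`, `k`, `R₀`, the base vertex `v₀` only) with
  `‖F(z)‖ ≤ C ‖M(v₀)‖` and `‖M(v₀)‖ ≤ C ‖F(z)‖` whenever `v₀` is `N`-deep: normalised fields are
  locally bounded ("precompact") and either alive or dead near `v₀`.

Sources: H. Duminil-Copin, S. Smirnov, Ann. of Math. 175 (2012) 1653–1665 (arXiv:1007.0575),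
Lemma 1; the line card `Cruxes/InteriorFlattening/Lines/liouville-local-limits.md` (First lemma
"lattice Harnack from no-fold"). Axioms `propext`, `Classical.choice`, `Quot.sound` only.
-/

noncomputable section

open scoped BigOperators
open Literature.Probability.LatticeModels Literature.Probability.RandomPlanarGeometry.SAW
open Summit.CriticalPhenomena.SAWScalingLimit.Theorems.InteriorFlattening.OneMouth
open Summit.CriticalPhenomena.SAWScalingLimit.Theorems.ObservableToSLE.FloorRatio (exists_walk_dist_le_dist)

namespace Summit.CriticalPhenomena.SAWScalingLimit.Theorems.InteriorFlattening.Liouville.Harnack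

/-! ### The cube root of unity -/

/-- `1 + ω + ω² = 0` and `ω³ = 1` for the crux's `ω = e^{2πi/3} = ζ²`. -/
theorem omega_facts : 1 + omega + omega ^ 2 = 0 ∧ omega ^ 3 = 1 := by
  refine ⟨?_, ?_⟩
  · rw [omega_eq_triZeta_sq]
    linear_combination (triZeta ^ 2 + triZeta + 1) * triZeta_sq
  · rw [omega_eq_triZeta_sq, ← pow_mul]
    exact triZeta_pow_six

/-! ### (a) One vertex: the inverse `ℤ/3`-Fourier transform -/

/-- One mode inequality: from `3F = M + cB`, `‖c‖ = 1`, `‖B‖ ≤ k‖M‖` get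
`(1-k)‖M‖ ≤ 3‖F‖ ≤ (1+k)‖M‖`. -/
theorem mode_aux {F M B c : ℂ} {k : ℝ} (e : (3 : ℂ) * F = M + c * B) (hc : ‖c‖ = 1)
    (hB : ‖B‖ ≤ k * ‖M‖) : (1 - k) * ‖M‖ ≤ 3 * ‖F‖ ∧ 3 * ‖F‖ ≤ (1 + k) * ‖M‖ := by
  have h3n : ‖(3 : ℂ)‖ = 3 := by norm_num
  have hcB : ‖c * B‖ = ‖B‖ := by rw [norm_mul, hc, one_mul]
  have n0 : 3 * ‖F‖ ≤ ‖M‖ + ‖B‖ := by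
    calc 3 * ‖F‖ = ‖(3 : ℂ) * F‖ := by rw [norm_mul, h3n]
      _ = ‖M + c * B‖ := by rw [e]
      _ ≤ ‖M‖ + ‖c * B‖ := norm_add_le _ _
      _ = ‖M‖ + ‖B‖ := by rw [hcB]
  have n1 : ‖M‖ ≤ 3 * ‖F‖ + ‖B‖ := by
    have hMeq : M = 3 * F - c * B := by linear_combination (-1 : ℂ) * e
    calc ‖M‖ = ‖(3 : ℂ) * F - c * B‖ := by rw [← hMeq]
      _ ≤ ‖(3 : ℂ) * F‖ + ‖c * B‖ := norm_sub_le _ _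
      _ = 3 * ‖F‖ + ‖B‖ := by rw [norm_mul, h3n, hcB]
  constructor <;> linarith

/-- **Lattice Harnack at one vertex (pure algebra).** For three complex numbers with vanishing
counter-clockwise combination `F₀ + ω²F₁ + ωF₂ = 0` (DCS Lemma 1 for the observable) and Beltrami
quotient `‖F₀ + ωF₁ + ω²F₂‖ ≤ k ‖F₀ + F₁ + F₂‖`, each modulus is pinched:
`(1-k)‖M‖ ≤ 3‖Fᵢ‖ ≤ (1+k)‖M‖`, `M = F₀ + F₁ + F₂` (inverse `ℤ/3`-DFT: `3F₀ = M + B`,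
`3F₁ = M + ω²B`, `3F₂ = M + ωB`). No sign condition on `k` is needed. -/
theorem modes_bounds {F₀ F₁ F₂ : ℂ} {k : ℝ}
    (hD : F₀ + omega ^ 2 * F₁ + omega * F₂ = 0)
    (hB : ‖F₀ + omega * F₁ + omega ^ 2 * F₂‖ ≤ k * ‖F₀ + F₁ + F₂‖) :
    ((1 - k) * ‖F₀ + F₁ + F₂‖ ≤ 3 * ‖F₀‖ ∧ 3 * ‖F₀‖ ≤ (1 + k) * ‖F₀ + F₁ + F₂‖) ∧
    ((1 - k) * ‖F₀ + F₁ + F₂‖ ≤ 3 * ‖F₁‖ ∧ 3 * ‖F₁‖ ≤ (1 + k) * ‖F₀ + F₁ + F₂‖) ∧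
    ((1 - k) * ‖F₀ + F₁ + F₂‖ ≤ 3 * ‖F₂‖ ∧ 3 * ‖F₂‖ ≤ (1 + k) * ‖F₀ + F₁ + F₂‖) := by
  obtain ⟨h1, h3⟩ := omega_facts
  have hω : ‖omega‖ = 1 := norm_omega
  have hω2 : ‖omega ^ 2‖ = 1 := by rw [norm_pow, hω, one_pow]
  have e0 : (3 : ℂ) * F₀ = (F₀ + F₁ + F₂) + 1 * (F₀ + omega * F₁ + omega ^ 2 * F₂) := by
    linear_combination hD - (F₁ + F₂) * h1
  have e1 : (3 : ℂ) * F₁ = (F₀ + F₁ + F₂) + omega ^ 2 * (F₀ + omega * F₁ + omega ^ 2 * F₂) := by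
    linear_combination (-(1 + omega ^ 2)) * hD + F₁ * h1 + (omega - 1) * (F₁ - F₂) * h3
  have e2 : (3 : ℂ) * F₂ = (F₀ + F₁ + F₂) + omega * (F₀ + omega * F₁ + omega ^ 2 * F₂) := by
    linear_combination (-(1 + omega)) * hD + F₂ * h1 + (F₁ - F₂) * h3
  exact ⟨mode_aux e0 norm_one hB, mode_aux e1 hω2 hB, mode_aux e2 hω hB⟩

/-! ### Frames: every vertex has exactly three neighbours -/

/-- Every honeycomb vertex carries a labelled star. -/
theorem exists_isStar (v : HexVertex) : ∃ w₀ w₁ w₂ : HexVertex, IsStar v w₀ w₁ w₂ := by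
  obtain ⟨x, y, z, hxy, hxz, hyz, h⟩ := Set.ncard_eq_three.1 (card_neighborSet_hexGraph_holds v)
  have hmem : ∀ w, w ∈ ({x, y, z} : Set HexVertex) → hexGraph.Adj v w := fun w hw => by
    rw [← h] at hw
    exact (SimpleGraph.mem_neighborSet _ _ _).1 hw
  exact ⟨x, y, z, hmem x (by simp), hmem y (by simp), hmem z (by simp), hxy, hyz, hxz⟩

/-- A labelled star lists ALL neighbours: any neighbour of `v` is one of `w₀, w₁, w₂`. -/
theorem mem_of_isStar {v w₀ w₁ w₂ w : HexVertex} (hs : IsStar v w₀ w₁ w₂)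
    (hw : hexGraph.Adj v w) : w = w₀ ∨ w = w₁ ∨ w = w₂ := by
  obtain ⟨h₀, h₁, h₂, h01, h12, h02⟩ := hs
  have hsub : ({w₀, w₁, w₂} : Set HexVertex) ⊆ hexGraph.neighborSet v := by
    intro x hx
    simp only [Set.mem_insert_iff, Set.mem_singleton_iff] at hx
    rw [SimpleGraph.mem_neighborSet]
    rcases hx with rfl | rfl | rfl
    exacts [h₀, h₁, h₂]
  have hcard : ({w₀, w₁, w₂} : Set HexVertex).ncard = 3 :=
    Set.ncard_eq_three.2 ⟨w₀, w₁, w₂, h01, h02, h12, rfl⟩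
  have h3 := card_neighborSet_hexGraph_holds v
  have hfin : (hexGraph.neighborSet v).Finite :=
    Set.finite_of_ncard_ne_zero (by rw [h3]; norm_num)
  have heq : ({w₀, w₁, w₂} : Set HexVertex) = hexGraph.neighborSet v :=
    Set.eq_of_subset_of_ncard_le hsub (by rw [hcard, h3]) hfin
  have hw' : w ∈ ({w₀, w₁, w₂} : Set HexVertex) := by
    rw [heq, SimpleGraph.mem_neighborSet]; exact hw
  simpa only [Set.mem_insert_iff, Set.mem_singleton_iff] using hw'

/-! ### (b) The observable at a deep vertex -/

/-- **Star bounds for the observable.** Under `DepthFlat R₀ k`, at an `R₀`-deep vertex `v` of a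
simply connected `Λ` with boundary root `a`, for every frame `(w₀, w₁, w₂)`:
`(1-k)‖M‖ ≤ 3‖F{v,wᵢ}‖ ≤ (1+k)‖M‖` for `i = 0, 1, 2`, `M = mono Λ a v w₀ w₁ w₂`. One of the two
labellings `(w₀,w₁,w₂)`, `(w₀,w₂,w₁)` is counter-clockwise (`hexStar_directions`); there DCS
Lemma 1 gives the vanishing combination (`bel_eq_zero_of_ccw`), and the no-fold bound at the other
labelling is the Beltrami quotient; then `modes_bounds`. -/
theorem star_bounds {k R₀ : ℝ} (hR : DepthFlat R₀ k) {Λ : Finset HexVertex} {a : Sym2 HexVertex}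
    (hΛ : hexDomainSimplyConnected Λ) (ha : a ∈ hexDomainBoundary Λ) {v : HexVertex} (hv : v ∈ Λ)
    (hd : Deep Λ v R₀) {w₀ w₁ w₂ : HexVertex} (hs : IsStar v w₀ w₁ w₂) :
    ((1 - k) * ‖mono Λ a v w₀ w₁ w₂‖ ≤ 3 * ‖Fobs Λ a s(v, w₀)‖ ∧
      3 * ‖Fobs Λ a s(v, w₀)‖ ≤ (1 + k) * ‖mono Λ a v w₀ w₁ w₂‖) ∧
    ((1 - k) * ‖mono Λ a v w₀ w₁ w₂‖ ≤ 3 * ‖Fobs Λ a s(v, w₁)‖ ∧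
      3 * ‖Fobs Λ a s(v, w₁)‖ ≤ (1 + k) * ‖mono Λ a v w₀ w₁ w₂‖) ∧
    ((1 - k) * ‖mono Λ a v w₀ w₁ w₂‖ ≤ 3 * ‖Fobs Λ a s(v, w₂)‖ ∧
      3 * ‖Fobs Λ a s(v, w₂)‖ ≤ (1 + k) * ‖mono Λ a v w₀ w₁ w₂‖) := by
  obtain ⟨hae, u, c₀, rfl, hc₀, hu⟩ := ha
  have huc : hexGraph.Adj u c₀ := by simpa using hae
  have ha' : s(u, c₀) ∈ hexDomainBoundary Λ := ⟨hae, u, c₀, rfl, hc₀, hu⟩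
  obtain ⟨h₀, h₁, h₂, h01, h12, h02⟩ := hs
  set F₀ := Fobs Λ s(u, c₀) s(v, w₀)
  set F₁ := Fobs Λ s(u, c₀) s(v, w₁)
  set F₂ := Fobs Λ s(u, c₀) s(v, w₂)
  have hmono : mono Λ s(u, c₀) v w₀ w₁ w₂ = F₀ + F₁ + F₂ := rfl
  rcases hexStar_directions h₀ h₁ h₂ h01 h12 h02 with ⟨hd₁, hd₂⟩ | ⟨hd₁, hd₂⟩
  · -- `(w₀, w₁, w₂)` counter-clockwise: Lemma 1 here, no-fold at `(w₀, w₂, w₁)`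
    have hL := bel_eq_zero_of_ccw hΛ hu hc₀ huc hv ⟨h₀, h₁, h₂, h01, h12, h02⟩ hd₁ hd₂
    have hD : F₀ + omega ^ 2 * F₂ + omega * F₁ = 0 := by
      have h' : F₀ + omega * F₁ + omega ^ 2 * F₂ = 0 := hL
      linear_combination h'
    have hB : ‖F₀ + omega * F₂ + omega ^ 2 * F₁‖ ≤ k * ‖F₀ + F₂ + F₁‖ :=
      hR Λ hΛ _ ha' v hv hd w₀ w₂ w₁ ⟨h₀, h₂, h₁, h02, h12.symm, h01⟩
    obtain ⟨b0, b2, b1⟩ := modes_bounds hD hB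
    have hM : F₀ + F₂ + F₁ = F₀ + F₁ + F₂ := by ring
    rw [hM] at b0 b1 b2
    rw [hmono]
    exact ⟨b0, b1, b2⟩
  · -- `(w₀, w₁, w₂)` clockwise: Lemma 1 at `(w₀, w₂, w₁)`, no-fold here
    have hL := bel_eq_zero_of_ccw hΛ hu hc₀ huc hv ⟨h₀, h₂, h₁, h02, h12.symm, h01⟩ hd₂ hd₁
    have hD : F₀ + omega ^ 2 * F₁ + omega * F₂ = 0 := by
      have h' : F₀ + omega * F₂ + omega ^ 2 * F₁ = 0 := hL
      linear_combination h'
    have hB : ‖F₀ + omega * F₁ + omega ^ 2 * F₂‖ ≤ k * ‖F₀ + F₁ + F₂‖ :=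
      hR Λ hΛ _ ha' v hv hd w₀ w₁ w₂ ⟨h₀, h₁, h₂, h01, h12, h02⟩
    rw [hmono]
    exact modes_bounds hD hB

/-- **Comparability of edge moduli at a deep vertex**: `‖F{v,w}‖ ≤ K ‖F{v,w'}‖` with
`K = (1+k)/(1-k)` for any two neighbours `w, w'` of an `R₀`-deep `v ∈ Λ` (`0 ≤ k < 1`). -/
theorem norm_Fobs_le_of_adj {k R₀ : ℝ} (hk0 : 0 ≤ k) (hk1 : k < 1) (hR : DepthFlat R₀ k)
    {Λ : Finset HexVertex} {a : Sym2 HexVertex} (hΛ : hexDomainSimplyConnected Λ)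
    (ha : a ∈ hexDomainBoundary Λ) {v : HexVertex} (hv : v ∈ Λ) (hd : Deep Λ v R₀)
    {w w' : HexVertex} (hw : hexGraph.Adj v w) (hw' : hexGraph.Adj v w') :
    ‖Fobs Λ a s(v, w)‖ ≤ (1 + k) / (1 - k) * ‖Fobs Λ a s(v, w')‖ := by
  obtain ⟨w₀, w₁, w₂, hs⟩ := exists_isStar v
  obtain ⟨b0, b1, b2⟩ := star_bounds hR hΛ ha hv hd hs
  have h1k : 0 < 1 - k := by linarith
  have hup : 3 * ‖Fobs Λ a s(v, w)‖ ≤ (1 + k) * ‖mono Λ a v w₀ w₁ w₂‖ := by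
    rcases mem_of_isStar hs hw with rfl | rfl | rfl
    exacts [b0.2, b1.2, b2.2]
  have hlo : (1 - k) * ‖mono Λ a v w₀ w₁ w₂‖ ≤ 3 * ‖Fobs Λ a s(v, w')‖ := by
    rcases mem_of_isStar hs hw' with rfl | rfl | rfl
    exacts [b0.1, b1.1, b2.1]
  rw [div_mul_eq_mul_div, le_div_iff₀ h1k]
  have s1 : 3 * ‖Fobs Λ a s(v, w)‖ * (1 - k) ≤ (1 + k) * ‖mono Λ a v w₀ w₁ w₂‖ * (1 - k) :=
    mul_le_mul_of_nonneg_right hup h1k.le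
  have s2 : (1 + k) * ((1 - k) * ‖mono Λ a v w₀ w₁ w₂‖) ≤ (1 + k) * (3 * ‖Fobs Λ a s(v, w')‖) :=
    mul_le_mul_of_nonneg_left hlo (by linarith)
  nlinarith [s1, s2]

/-- **`mono = 0 ↔ the star vanishes`** at an `R₀`-deep vertex (`k < 1` for `→` is not even needed:
the upper bounds `3‖Fᵢ‖ ≤ (1+k)‖M‖` suffice). -/
theorem mono_eq_zero_iff {k R₀ : ℝ} (hR : DepthFlat R₀ k) {Λ : Finset HexVertex}
    {a : Sym2 HexVertex} (hΛ : hexDomainSimplyConnected Λ) (ha : a ∈ hexDomainBoundary Λ)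
    {v : HexVertex} (hv : v ∈ Λ) (hd : Deep Λ v R₀) {w₀ w₁ w₂ : HexVertex}
    (hs : IsStar v w₀ w₁ w₂) :
    mono Λ a v w₀ w₁ w₂ = 0 ↔
      Fobs Λ a s(v, w₀) = 0 ∧ Fobs Λ a s(v, w₁) = 0 ∧ Fobs Λ a s(v, w₂) = 0 := by
  constructor
  · intro h
    obtain ⟨b0, b1, b2⟩ := star_bounds hR hΛ ha hv hd hs
    rw [h, norm_zero, mul_zero, mul_zero] at b0 b1 b2
    refine ⟨?_, ?_, ?_⟩ <;> rw [← norm_eq_zero] <;>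
      linarith [b0.2, b1.2, b2.2, norm_nonneg (Fobs Λ a s(v, w₀)), norm_nonneg (Fobs Λ a s(v, w₁)),
        norm_nonneg (Fobs Λ a s(v, w₂))]
  · rintro ⟨e0, e1, e2⟩
    unfold mono
    rw [e0, e1, e2, add_zero, add_zero]

/-- **One dead edge kills the star**: if `F{v,w} = 0` for ONE neighbour `w` of an `R₀`-deep
vertex (`k < 1`), then `mono Λ a v · · · = 0` in every frame (hence all three edges vanish, by
`mono_eq_zero_iff`). -/
theorem mono_eq_zero_of_Fobs_eq_zero {k R₀ : ℝ} (hk1 : k < 1) (hR : DepthFlat R₀ k)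
    {Λ : Finset HexVertex} {a : Sym2 HexVertex} (hΛ : hexDomainSimplyConnected Λ)
    (ha : a ∈ hexDomainBoundary Λ) {v : HexVertex} (hv : v ∈ Λ) (hd : Deep Λ v R₀)
    {w₀ w₁ w₂ : HexVertex} (hs : IsStar v w₀ w₁ w₂) {w : HexVertex} (hw : hexGraph.Adj v w)
    (h0 : Fobs Λ a s(v, w) = 0) : mono Λ a v w₀ w₁ w₂ = 0 := by
  obtain ⟨b0, b1, b2⟩ := star_bounds hR hΛ ha hv hd hs
  have hlo : (1 - k) * ‖mono Λ a v w₀ w₁ w₂‖ ≤ 3 * ‖Fobs Λ a s(v, w)‖ := by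
    rcases mem_of_isStar hs hw with rfl | rfl | rfl
    exacts [b0.1, b1.1, b2.1]
  rw [h0, norm_zero, mul_zero] at hlo
  have h1k : 0 < 1 - k := by linarith
  rw [← norm_eq_zero]
  nlinarith [norm_nonneg (mono Λ a v w₀ w₁ w₂)]

/-! ### (c) Chains along lattice walks -/

/-- **Harnack chain.** Along a lattice walk `p : u ⟶ v` all of whose vertices lie in `Λ` and are
`R₀`-deep, edge moduli at the two ends compare with `K^(len p + 1)`, `K = (1+k)/(1-k)`: for any
neighbour `w` of `u` and `w'` of `v`, `‖F{v,w'}‖ ≤ K^(len+1) ‖F{u,w}‖` and conversely. -/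
theorem chain {k R₀ : ℝ} (hk0 : 0 ≤ k) (hk1 : k < 1) (hR : DepthFlat R₀ k)
    {Λ : Finset HexVertex} {a : Sym2 HexVertex} (hΛ : hexDomainSimplyConnected Λ)
    (ha : a ∈ hexDomainBoundary Λ) {u v : HexVertex} (p : hexGraph.Walk u v) :
    (∀ x ∈ p.support, x ∈ Λ ∧ Deep Λ x R₀) → ∀ {w w' : HexVertex}, hexGraph.Adj u w →
      hexGraph.Adj v w' →
        ‖Fobs Λ a s(v, w')‖ ≤ ((1 + k) / (1 - k)) ^ (p.length + 1) * ‖Fobs Λ a s(u, w)‖ ∧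
        ‖Fobs Λ a s(u, w)‖ ≤ ((1 + k) / (1 - k)) ^ (p.length + 1) * ‖Fobs Λ a s(v, w')‖ := by
  have hK : 0 ≤ (1 + k) / (1 - k) := div_nonneg (by linarith) (by linarith)
  induction p with
  | nil =>
    intro hp w w' hw hw'
    rename_i u
    have hu := hp u (SimpleGraph.Walk.start_mem_support _)
    simp only [SimpleGraph.Walk.length_nil, zero_add, pow_one]
    exact ⟨norm_Fobs_le_of_adj hk0 hk1 hR hΛ ha hu.1 hu.2 hw' hw,
      norm_Fobs_le_of_adj hk0 hk1 hR hΛ ha hu.1 hu.2 hw hw'⟩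
  | cons h p' ih =>
    intro hp w w' hw hw'
    rename_i u u₁ v
    have hu := hp u (SimpleGraph.Walk.start_mem_support _)
    have hp' : ∀ x ∈ p'.support, x ∈ Λ ∧ Deep Λ x R₀ := fun x hx =>
      hp x (by rw [SimpleGraph.Walk.support_cons]; exact List.mem_cons_of_mem _ hx)
    obtain ⟨ih1, ih2⟩ := ih hp' h.symm hw'
    have e : Fobs Λ a s(u₁, u) = Fobs Λ a s(u, u₁) := by rw [Sym2.eq_swap]
    rw [e] at ih1 ih2
    have c1 := norm_Fobs_le_of_adj hk0 hk1 hR hΛ ha hu.1 hu.2 h hw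
    have c2 := norm_Fobs_le_of_adj hk0 hk1 hR hΛ ha hu.1 hu.2 hw h
    simp only [SimpleGraph.Walk.length_cons]
    constructor
    · calc ‖Fobs Λ a s(v, w')‖
          ≤ ((1 + k) / (1 - k)) ^ (p'.length + 1) * ‖Fobs Λ a s(u, u₁)‖ := ih1
        _ ≤ ((1 + k) / (1 - k)) ^ (p'.length + 1) * ((1 + k) / (1 - k) * ‖Fobs Λ a s(u, w)‖) :=
          mul_le_mul_of_nonneg_left c1 (pow_nonneg hK _)
        _ = ((1 + k) / (1 - k)) ^ (p'.length + 1 + 1) * ‖Fobs Λ a s(u, w)‖ := by ring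
    · calc ‖Fobs Λ a s(u, w)‖ ≤ (1 + k) / (1 - k) * ‖Fobs Λ a s(u, u₁)‖ := c2
        _ ≤ (1 + k) / (1 - k) * (((1 + k) / (1 - k)) ^ (p'.length + 1) * ‖Fobs Λ a s(v, w')‖) :=
          mul_le_mul_of_nonneg_left ih2 hK
        _ = ((1 + k) / (1 - k)) ^ (p'.length + 1 + 1) * ‖Fobs Λ a s(v, w')‖ := by ring

/-- **Depth along a walk inside a disc.** If `v₀` is `n`-deep, a walk towards `v₀` inside the
disc through its start `u` (all vertices within `dist(c_u, c_{v₀})` of `c_{v₀}`) consists of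
vertices of `Λ` that are `R₀`-deep, as soon as `dist(c_u, c_{v₀}) + max R₀ 0 ≤ n` (triangle
inequality). -/
theorem support_deep {Λ : Finset HexVertex} {v₀ u : HexVertex} {n R₀ : ℝ} (hn : Deep Λ v₀ n)
    (p : hexGraph.Walk u v₀)
    (hp : ∀ x ∈ p.support, dist (hexCenter x) (hexCenter v₀) ≤ dist (hexCenter u) (hexCenter v₀))
    (hle : dist (hexCenter u) (hexCenter v₀) + max R₀ 0 ≤ n) :
    ∀ x ∈ p.support, x ∈ Λ ∧ Deep Λ x R₀ := by
  intro x hx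
  have hx' := hp x hx
  have hR : R₀ ≤ max R₀ 0 := le_max_left _ _
  have h0 : 0 ≤ max R₀ 0 := le_max_right _ _
  refine ⟨hn x (by linarith), fun w hw => hn w ?_⟩
  calc dist (hexCenter w) (hexCenter v₀)
      ≤ dist (hexCenter w) (hexCenter x) + dist (hexCenter x) (hexCenter v₀) := dist_triangle _ _ _
    _ ≤ n := by linarith

/-- **Two-sided Harnack bounds at depth (explicit form).** Under `DepthFlat R₀ k` (`0 ≤ k < 1`),
for a base vertex `v₀` with frame `(w₀, w₁, w₂)` and any vertex `v` there is `m : ℕ` (the length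
of a lattice walk from `v` to `v₀` inside the disc through `c_v`) such that for every simply
connected `Λ` with boundary root `a` in which `v₀` is `n`-deep,
`n ≥ dist(c_v, c_{v₀}) + max R₀ 0`, and every neighbour `w` of `v`:
`‖F{v,w}‖ ≤ (1+k)/3 · K^(m+1) ‖M(v₀)‖` and `‖M(v₀)‖ ≤ 3/(1-k) · K^(m+1) ‖F{v,w}‖`. -/
theorem bounds_of_deep {k R₀ : ℝ} (hk0 : 0 ≤ k) (hk1 : k < 1) (hR : DepthFlat R₀ k)
    {v₀ w₀ w₁ w₂ : HexVertex} (hs : IsStar v₀ w₀ w₁ w₂) (v : HexVertex) :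
    ∃ m : ℕ, ∀ (Λ : Finset HexVertex) (a : Sym2 HexVertex) (n : ℝ),
      dist (hexCenter v) (hexCenter v₀) + max R₀ 0 ≤ n → hexDomainSimplyConnected Λ →
      a ∈ hexDomainBoundary Λ → Deep Λ v₀ n → ∀ w : HexVertex, hexGraph.Adj v w →
        ‖Fobs Λ a s(v, w)‖ ≤
            (1 + k) / 3 * ((1 + k) / (1 - k)) ^ (m + 1) * ‖mono Λ a v₀ w₀ w₁ w₂‖ ∧
        ‖mono Λ a v₀ w₀ w₁ w₂‖ ≤
            3 / (1 - k) * ((1 + k) / (1 - k)) ^ (m + 1) * ‖Fobs Λ a s(v, w)‖ := by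
  obtain ⟨p, hp⟩ := exists_walk_dist_le_dist v v₀
  refine ⟨p.length, fun Λ a n hle hΛ ha hn w hw => ?_⟩
  have h1k : 0 < 1 - k := by linarith
  have hK : 0 ≤ (1 + k) / (1 - k) := div_nonneg (by linarith) h1k.le
  have hKm : 0 ≤ ((1 + k) / (1 - k)) ^ (p.length + 1) := pow_nonneg hK _
  have h0n : 0 ≤ n := le_trans (add_nonneg dist_nonneg (le_max_right _ _)) hle
  have hv₀ : v₀ ∈ Λ := hn v₀ (by rw [dist_self]; exact h0n)
  have hd₀ : Deep Λ v₀ R₀ := fun x hx => hn x (by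
    have hd : (0 : ℝ) ≤ dist (hexCenter v) (hexCenter v₀) := dist_nonneg
    linarith [le_max_left R₀ 0])
  have hsupp := support_deep hn p hp hle
  obtain ⟨c1, c2⟩ := chain hk0 hk1 hR hΛ ha p hsupp hw hs.1
  obtain ⟨⟨b0l, b0u⟩, -, -⟩ := star_bounds hR hΛ ha hv₀ hd₀ hs
  constructor
  · -- ‖F{v,w}‖ ≤ K^(m+1) ‖F{v₀,w₀}‖ ≤ K^(m+1) (1+k)/3 ‖M‖
    have hF0 : ‖Fobs Λ a s(v₀, w₀)‖ ≤ (1 + k) / 3 * ‖mono Λ a v₀ w₀ w₁ w₂‖ := by linarith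
    calc ‖Fobs Λ a s(v, w)‖ ≤ ((1 + k) / (1 - k)) ^ (p.length + 1) * ‖Fobs Λ a s(v₀, w₀)‖ := c2
      _ ≤ ((1 + k) / (1 - k)) ^ (p.length + 1) * ((1 + k) / 3 * ‖mono Λ a v₀ w₀ w₁ w₂‖) :=
        mul_le_mul_of_nonneg_left hF0 hKm
      _ = (1 + k) / 3 * ((1 + k) / (1 - k)) ^ (p.length + 1) * ‖mono Λ a v₀ w₀ w₁ w₂‖ := by ring
  · have hM : ‖mono Λ a v₀ w₀ w₁ w₂‖ ≤ 3 / (1 - k) * ‖Fobs Λ a s(v₀, w₀)‖ := by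
      rw [div_mul_eq_mul_div, le_div_iff₀ h1k]; linarith
    calc ‖mono Λ a v₀ w₀ w₁ w₂‖ ≤ 3 / (1 - k) * ‖Fobs Λ a s(v₀, w₀)‖ := hM
      _ ≤ 3 / (1 - k) * (((1 + k) / (1 - k)) ^ (p.length + 1) * ‖Fobs Λ a s(v, w)‖) :=
        mul_le_mul_of_nonneg_left c1 (div_nonneg (by norm_num) h1k.le)
      _ = 3 / (1 - k) * ((1 + k) / (1 - k)) ^ (p.length + 1) * ‖Fobs Λ a s(v, w)‖ := by ring

/-- **Edges are bounded by the monopole at depth** (registered sub-goal of the crux; the form the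
compactness stub S2 and the reduction S7 consume, via the Liouville wrapper
`…LiouvilleHarnack.lean`). Under `DepthFlat R₀ k` (`0 ≤ k < 1`), for a base vertex `v₀` with
frame `(w₀, w₁, w₂)` and an edge `z` of the honeycomb lattice there are constants `C, N`
(depending on `z, k, R₀, v₀` only) such that `‖F(z)‖ ≤ C ‖M(v₀)‖` for every simply connected `Λ`,
boundary root `a`, once `v₀` is `N`-deep in `Λ`. -/
theorem Fobs_le_mono_of_deep : ∀ (k R₀ : ℝ), 0 ≤ k → k < 1 → DepthFlat R₀ k →
    ∀ (v₀ w₀ w₁ w₂ : HexVertex), IsStar v₀ w₀ w₁ w₂ → ∀ z ∈ hexGraph.edgeSet, ∃ C N : ℝ,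
      ∀ (Λ : Finset HexVertex) (a : Sym2 HexVertex) (n : ℝ), N ≤ n →
        hexDomainSimplyConnected Λ → a ∈ hexDomainBoundary Λ → Deep Λ v₀ n →
          ‖Fobs Λ a z‖ ≤ C * ‖mono Λ a v₀ w₀ w₁ w₂‖ := by
  intro k R₀ hk0 hk1 hR v₀ w₀ w₁ w₂ hs z hz
  induction z using Sym2.ind with
  | h v w =>
    have hvw : hexGraph.Adj v w := (SimpleGraph.mem_edgeSet _).1 hz
    obtain ⟨m, hm⟩ := bounds_of_deep hk0 hk1 hR hs v
    exact ⟨(1 + k) / 3 * ((1 + k) / (1 - k)) ^ (m + 1),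
      dist (hexCenter v) (hexCenter v₀) + max R₀ 0,
      fun Λ a n hN hΛ ha hn => (hm Λ a n hN hΛ ha hn w hvw).1⟩

/-- **The monopole is bounded by any edge at depth** (the converse chain: "alive or dead"). Under
`DepthFlat R₀ k` (`0 ≤ k < 1`), for a base vertex `v₀` with frame `(w₀, w₁, w₂)` and an edge `z`
there are `C, N` (depending on `z, k, R₀, v₀` only) with `‖M(v₀)‖ ≤ C ‖F(z)‖` once `v₀` is
`N`-deep; in particular if the observable vanishes at one deep edge it vanishes on the star of
`v₀`, and conversely. -/
theorem mono_le_Fobs_of_deep : ∀ (k R₀ : ℝ), 0 ≤ k → k < 1 → DepthFlat R₀ k →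
    ∀ (v₀ w₀ w₁ w₂ : HexVertex), IsStar v₀ w₀ w₁ w₂ → ∀ z ∈ hexGraph.edgeSet, ∃ C N : ℝ,
      ∀ (Λ : Finset HexVertex) (a : Sym2 HexVertex) (n : ℝ), N ≤ n →
        hexDomainSimplyConnected Λ → a ∈ hexDomainBoundary Λ → Deep Λ v₀ n →
          ‖mono Λ a v₀ w₀ w₁ w₂‖ ≤ C * ‖Fobs Λ a z‖ := by
  intro k R₀ hk0 hk1 hR v₀ w₀ w₁ w₂ hs z hz
  induction z using Sym2.ind with
  | h v w =>
    have hvw : hexGraph.Adj v w := (SimpleGraph.mem_edgeSet _).1 hz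
    obtain ⟨m, hm⟩ := bounds_of_deep hk0 hk1 hR hs v
    exact ⟨3 / (1 - k) * ((1 + k) / (1 - k)) ^ (m + 1),
      dist (hexCenter v) (hexCenter v₀) + max R₀ 0,
      fun Λ a n hN hΛ ha hn => (hm Λ a n hN hΛ ha hn w hvw).2⟩

end Summit.CriticalPhenomena.SAWScalingLimit.Theorems.InteriorFlattening.Liouville.Harnack

end
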